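import Literature.Analysis.ValidatedNumerics.TaylorModel
import Literature.Analysis.ValidatedNumerics.ExpPoly.Poly
import Mathlib.Analysis.Complex.Exponential
import HarnessLib

/-!
# Taylor models of `exp`, of rational polynomials of a Taylor model, and of `φ(u) = (1 − e^{-u})/u`

Trunk T-ANA (Analysis/ValidatedNumerics); namespace `Literature.Analysis.ValidatedNumerics.PolyMP`.
Sequel of `TaylorModel.lean` (`TMem S h f P`: on `|ρ| ≤ h`, `f(ρ) = Σ aᵢ ρⁱ` with `aᵢ ∈ Pᵢ`).  That file
and `TaylorModelExpr.lean` provide the polynomial arithmetic of Taylor models and the verification rules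
for `1/g` and `√g`; this file supplies the TRANSCENDENTAL INPUTS needed to enclose integrands such as
`t ρ(t) = t e^{-t/2}/(1 − e^{-2t}) = e^{-t/2}/(2φ(2t))` (the archimedean density of Weil's explicit
formula) panel by panel:

* `texpI S h K q` with `tmem_exp`: a Taylor model of `ρ ↦ e^{qρ}` on `|ρ| ≤ h` (`|qh| ≤ 1`): the exact
  Taylor coefficients `q^k/k!`, `k < K`, rounded outward, and the Lagrange-type remainder
  `|qh|^K (K+1)/(K!·K)` (`Real.exp_bound`) folded into the constant coefficient;
* `thornerI S h D cs U` with `tmem_horner`: the Taylor model of `ρ ↦ p(u(ρ))` for a RATIONAL coefficient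
  list `p = cs` (Horner in Taylor-model arithmetic) — composition of an exact polynomial with an enclosed
  quantity;
* `phiExp u = (1 − e^{-u})/u` (value `1` at `u = 0`; entire) and `tphiI S h D K U` with `tmem_phi`: its
  Taylor model from the exponential series, `φ(u) = Σ_{k<K} (−u)^k/(k+1)! − R/u`,
  `|R/u| ≤ |u|^K (K+2)/((K+1)!(K+1))` for `|u| ≤ 1`.

Auxiliary: `evalR_append_singleton`, `evalR_map_range` (coefficient lists built with `List.range`
evaluate to the expected finite sums), `pmem_map`.  Problem-independent; no facts, no axioms.

## References

* K. Makino, M. Berz, *Taylor models and other validated functional inclusion methods*, Int. J. Pure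
  Appl. Math. 4 (2003) 379–456, §2 (intrinsic functions). [folklore]
* The exponential series with remainder, `|e^x − Σ_{m<n} x^m/m!| ≤ |x|^n (n+1)/(n!·n)` for `|x| ≤ 1`
  (Mathlib `Real.exp_bound`). [folklore]
-/

namespace Literature.Analysis.ValidatedNumerics

namespace PolyMP

open Literature.Analysis.ValidatedNumerics.NumericsMP
open Literature.Analysis.ValidatedNumerics.ExpPoly (Poly)

/-! ### Coefficient lists built with `List.range` -/

/-- `evalR (as ++ [a]) x = evalR as x + a·x^{|as|}`. [folklore] -/
theorem evalR_append_singleton (a : ℝ) : ∀ (as : List ℝ) (x : ℝ),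
    evalR (as ++ [a]) x = evalR as x + a * x ^ as.length
  | [], x => by simp
  | b :: bs, x => by
      rw [List.cons_append, evalR_cons, evalR_cons, evalR_append_singleton a bs x, List.length_cons, pow_succ]
      ring

/-- `evalR ((range K).map c) x = Σ_{k<K} c k · x^k`. [folklore] -/
theorem evalR_map_range (c : ℕ → ℝ) (x : ℝ) : ∀ K : ℕ,
    evalR ((List.range K).map c) x = ∑ k ∈ Finset.range K, c k * x ^ k
  | 0 => by simp
  | K + 1 => by
      rw [List.range_succ, List.map_append, List.map_singleton, evalR_append_singleton, evalR_map_range c x K,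
        Finset.sum_range_succ, List.length_map, List.length_range]

/-- Coefficientwise membership of two lists built by mapping the same index list. [folklore] -/
theorem pmem_map {S : ℕ} {ι : Type*} {f : ι → ℝ} {g : ι → MI} (hfg : ∀ i, MI.mem S (f i) (g i)) :
    ∀ l : List ι, PMem S (l.map f) (l.map g)
  | [] => by simpa using pmem_nil S
  | i :: l => by simpa using pmem_cons (hfg i) (pmem_map hfg l)

/-! ### The exponential -/

/-- Outward-rounded Taylor coefficients `q^k/k!`, `k < K`, of `e^{qρ}`. [folklore] -/
def texpCoeffs (S : ℕ) (q : ℚ) (K : ℕ) : IPoly :=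
  (List.range K).map fun k => ofRat S (q ^ k / (k.factorial : ℚ))

/-- Scaled remainder bound `⌈S · |qh|^K (K+1)/(K!·K)⌉`. [folklore] -/
def texpRem (S : ℕ) (h q : ℚ) (K : ℕ) : ℤ :=
  ⌈(S : ℚ) * (|q * h| ^ K * ((K + 1 : ℚ) / ((K.factorial : ℚ) * K)))⌉

/-- The Taylor model of `ρ ↦ e^{qρ}` on `|ρ| ≤ h`: Taylor polynomial of degree `< K` plus the remainder in
the constant coefficient. [folklore] -/
def texpI (S : ℕ) (h : ℚ) (K : ℕ) (q : ℚ) : IPoly :=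
  widen0 (texpCoeffs S q K) (texpRem S h q K)

/-- **Soundness of `texpI`.** For `0 < K` and `|q h| ≤ 1`, `texpI S h K q` encloses `ρ ↦ e^{qρ}` on `|ρ| ≤ h`
(`h ≥ 0` is implied by `|ρ| ≤ h`). [folklore] -/
theorem tmem_exp {S : ℕ} {h : ℚ} {K : ℕ} (hK : 0 < K) {q : ℚ} (hqh : |q * h| ≤ 1) :
    TMem S h (fun ρ => Real.exp (q * ρ)) (texpI S h K q) := by
  intro ρ hρ
  -- the exact Taylor coefficients
  set as : List ℝ := (List.range K).map fun k => ((q ^ k / (k.factorial : ℚ) : ℚ) : ℝ) with has_def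
  have has : PMem S as (texpCoeffs S q K) := pmem_map (fun k => mem_ofRat S _) _
  have hqh' : |(q : ℝ) * (h : ℝ)| ≤ 1 := by
    have := (Rat.cast_le (K := ℝ)).2 hqh
    push_cast at this
    exact this
  have hx : |(q : ℝ) * ρ| ≤ |(q : ℝ) * (h : ℝ)| := by
    rw [abs_mul, abs_mul]
    exact mul_le_mul_of_nonneg_left (hρ.trans (le_abs_self _)) (abs_nonneg _)
  have hx1 : |(q : ℝ) * ρ| ≤ 1 := hx.trans hqh'
  have hrem := Real.exp_bound hx1 hK
  set R : ℝ := Real.exp (q * ρ) - ∑ m ∈ Finset.range K, ((q : ℝ) * ρ) ^ m / m.factorial with hR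
  have hS0 : (0 : ℝ) ≤ S := by positivity
  have hc : (0 : ℝ) ≤ (K.succ : ℝ) / ((K.factorial : ℝ) * K) := by positivity
  have h1 : |R| ≤ |(q : ℝ) * (h : ℝ)| ^ K * ((K.succ : ℝ) / ((K.factorial : ℝ) * K)) :=
    hrem.trans (mul_le_mul_of_nonneg_right (pow_le_pow_left₀ (abs_nonneg _) hx K) hc)
  have h2 : ((S : ℚ) * (|q * h| ^ K * ((K + 1 : ℚ) / ((K.factorial : ℚ) * K))) : ℝ) ≤ (texpRem S h q K : ℝ) := by
    unfold texpRem; exact_mod_cast Int.le_ceil _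
  have hRle : |R| * S ≤ (texpRem S h q K : ℝ) := by
    refine le_trans ?_ h2
    calc |R| * S ≤ |(q : ℝ) * (h : ℝ)| ^ K * ((K.succ : ℝ) / ((K.factorial : ℝ) * K)) * S :=
          mul_le_mul_of_nonneg_right h1 hS0
      _ = ((S : ℚ) * (|q * h| ^ K * ((K + 1 : ℚ) / ((K.factorial : ℚ) * K))) : ℝ) := by
          push_cast; ring
  obtain ⟨bs, hbs, hev⟩ := exists_widen0 has hRle ρ
  refine ⟨bs, hbs, ?_⟩
  rw [hev, has_def, evalR_map_range, hR]
  have : ∀ m ∈ Finset.range K, ((q : ℝ) * ρ) ^ m / m.factorial = ((q ^ m / (m.factorial : ℚ) : ℚ) : ℝ) * ρ ^ m := by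
    intro m _; push_cast; rw [mul_pow]; ring
  rw [Finset.sum_congr rfl this]
  ring

/-! ### Rational polynomials of a Taylor model (Horner) -/

/-- `p(u(ρ))` in Taylor-model arithmetic, `p` a rational coefficient list (Horner, truncation degree `D`).
[folklore] -/
def thornerI (S : ℕ) (h : ℚ) (D : ℕ) : List ℚ → IPoly → IPoly
  | [], _ => tconst (MI.ofInt S 0)
  | c :: cs, U => taddI (tconst (ofRat S c)) (tmulI S h D U (thornerI S h D cs U))

/-- **Soundness of `thornerI`.** [folklore] -/
theorem tmem_horner {S : ℕ} (hS : 0 < S) {h : ℚ} (h0 : 0 ≤ h) (D : ℕ) {u : ℝ → ℝ} {U : IPoly}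
    (hu : TMem S h u U) : ∀ cs : List ℚ, TMem S h (fun ρ => Poly.eval cs (u ρ)) (thornerI S h D cs U)
  | [] => by
      simpa [thornerI] using (tmem_const (h := h) (MI.mem_ofInt S 0))
  | c :: cs => by
      have ih := tmem_horner hS h0 D hu cs
      have := tmem_add (tmem_const (h := h) (mem_ofRat S c)) (tmem_mul hS h0 D hu ih)
      simpa [thornerI, Poly.eval] using this

/-! ### `φ(u) = (1 − e^{-u})/u` -/

/-- `φ(u) = (1 − e^{-u})/u`, extended by its limit `1` at `u = 0` (an entire function;
`u/(1 − e^{-u}) = 1/φ(u)` is the generating function of the Bernoulli numbers `B_k^+`). [folklore] -/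
noncomputable def phiExp (u : ℝ) : ℝ := if u = 0 then 1 else (1 - Real.exp (-u)) / u

/-- The Taylor coefficients `(−1)^k/(k+1)!`, `k < K`, of `φ`. [folklore] -/
def phiCoeffs (K : ℕ) : List ℚ := (List.range K).map fun k => (-1) ^ k / ((k + 1).factorial : ℚ)

/-- `Poly.eval (l ++ [a]) x = Poly.eval l x + a·x^{|l|}`. [folklore] -/
theorem poly_eval_append_singleton (a : ℚ) (x : ℝ) : ∀ l : List ℚ,
    Poly.eval (l ++ [a]) x = Poly.eval l x + (a : ℝ) * x ^ l.length
  | [] => by simp [Poly.eval]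
  | b :: l => by
      rw [List.cons_append, Poly.eval_cons, Poly.eval_cons, poly_eval_append_singleton a x l, List.length_cons,
        pow_succ]
      ring

/-- `Poly.eval` of a `List.range`-built list is the finite sum. [folklore] -/
theorem poly_eval_map_range (c : ℕ → ℚ) (x : ℝ) : ∀ K : ℕ,
    Poly.eval ((List.range K).map c) x = ∑ k ∈ Finset.range K, (c k : ℝ) * x ^ k
  | 0 => by simp
  | K + 1 => by
      rw [List.range_succ, List.map_append, List.map_singleton, Finset.sum_range_succ, poly_eval_append_singleton,
        poly_eval_map_range c x K, List.length_map, List.length_range]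

/-- **Taylor expansion of `φ` with remainder**: for `|u| ≤ 1` and `0 < K`,
`|φ(u) − Σ_{k<K} (−u)^k/(k+1)!| ≤ |u|^K (K+2)/((K+1)!(K+1))`. [folklore] -/
theorem abs_phiExp_sub_le {u : ℝ} (hu : |u| ≤ 1) {K : ℕ} (hK : 0 < K) :
    |phiExp u - Poly.eval (phiCoeffs K) u| ≤ |u| ^ K * ((K + 2 : ℝ) / (((K + 1).factorial : ℝ) * (K + 1))) := by
  rw [phiCoeffs, poly_eval_map_range]
  by_cases h0 : u = 0
  · subst h0
    have : ∑ k ∈ Finset.range K, (((-1 : ℚ) ^ k / ((k + 1).factorial : ℚ) : ℚ) : ℝ) * (0 : ℝ) ^ k = 1 := by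
      rw [Finset.sum_eq_single 0]
      · simp
      · intro k _ hk; simp [hk]
      · intro h; exact absurd (Finset.mem_range.2 hK) h
    rw [phiExp, if_pos rfl, this]
    simp [zero_pow hK.ne']
  · -- exponential series for `e^{-u}` with `K + 1` terms
    have hx : |(-u)| ≤ 1 := by rwa [abs_neg]
    have hrem := Real.exp_bound hx (Nat.succ_pos K)
    rw [Finset.sum_range_succ'] at hrem
    simp only [pow_zero, Nat.factorial_zero, Nat.cast_one, div_one] at hrem
    -- `φ(u) − Σ = −R/u` with `R` the exponential remainder
    have hphi : phiExp u = (1 - Real.exp (-u)) / u := by rw [phiExp, if_neg h0]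
    have hsum : ∑ k ∈ Finset.range K, (((-1 : ℚ) ^ k / ((k + 1).factorial : ℚ) : ℚ) : ℝ) * u ^ k =
        -(∑ k ∈ Finset.range K, (-u) ^ (k + 1) / ((k + 1).factorial : ℝ)) / u := by
      rw [← Finset.sum_neg_distrib, Finset.sum_div]
      refine Finset.sum_congr rfl fun k _ => ?_
      push_cast
      rw [neg_pow, pow_succ]
      field_simp
      ring
    have hkey : phiExp u - ∑ k ∈ Finset.range K, (((-1 : ℚ) ^ k / ((k + 1).factorial : ℚ) : ℚ) : ℝ) * u ^ k =
        -(Real.exp (-u) - (∑ k ∈ Finset.range K, (-u) ^ (k + 1) / ((k + 1).factorial : ℝ) + 1)) / u := by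
      rw [hphi, hsum]; field_simp; ring
    rw [hkey, abs_div, abs_neg]
    have hupos : 0 < |u| := abs_pos.2 h0
    rw [div_le_iff₀ hupos]
    refine hrem.trans (le_of_eq ?_)
    simp only [abs_neg, Nat.succ_eq_add_one, Nat.factorial_succ, pow_succ]
    push_cast
    ring

/-- Scaled remainder bound for `φ` given a scaled range bound `B` (`|u| S ≤ B`): `⌈S (B/S)^K (K+2)/((K+1)!(K+1))⌉`.
[folklore] -/
def tphiRem (S : ℕ) (B : ℤ) (K : ℕ) : ℤ :=
  ⌈(S : ℚ) * (((B : ℚ) / S) ^ K * ((K + 2 : ℚ) / ((((K + 1).factorial : ℕ) : ℚ) * (K + 1))))⌉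

/-- The Taylor model of `ρ ↦ φ(u(ρ))`: Horner on the Taylor coefficients plus the remainder. [folklore] -/
def tphiI (S : ℕ) (h : ℚ) (D K : ℕ) (U : IPoly) : IPoly :=
  widen0 (thornerI S h D (phiCoeffs K) U) (tphiRem S (tabsI S h U) K)

/-- **Soundness of `tphiI`.** If `U` encloses `u` on `|ρ| ≤ h` and its range bound certifies `|u| ≤ 1`
(`tabsI S h U ≤ S`), then `tphiI S h D K U` encloses `ρ ↦ φ(u(ρ))`. [folklore] -/
theorem tmem_phi {S : ℕ} (hS : 0 < S) {h : ℚ} (h0 : 0 ≤ h) (D : ℕ) {K : ℕ} (hK : 0 < K) {u : ℝ → ℝ}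
    {U : IPoly} (hu : TMem S h u U) (hB : tabsI S h U ≤ S) :
    TMem S h (fun ρ => phiExp (u ρ)) (tphiI S h D K U) := by
  intro ρ hρ
  obtain ⟨as, has, hev⟩ := tmem_horner hS h0 D hu (phiCoeffs K) ρ hρ
  have hSr : (0 : ℝ) < S := by exact_mod_cast hS
  have habs := abs_le_tabsI h0 hu hρ
  have hu1 : |u ρ| ≤ 1 := by
    have : (tabsI S h U : ℝ) ≤ S := by exact_mod_cast hB
    nlinarith
  have huB : |u ρ| ≤ (tabsI S h U : ℝ) / S := by rw [le_div_iff₀ hSr]; exact habs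
  set δ : ℝ := phiExp (u ρ) - Poly.eval (phiCoeffs K) (u ρ) with hδ
  have hδle : |δ| * S ≤ (tphiRem S (tabsI S h U) K : ℝ) := by
    have h1 := abs_phiExp_sub_le hu1 hK
    have h2 : |u ρ| ^ K ≤ ((tabsI S h U : ℝ) / S) ^ K := pow_le_pow_left₀ (abs_nonneg _) huB K
    have hc : (0 : ℝ) ≤ (K + 2 : ℝ) / (((K + 1).factorial : ℝ) * (K + 1)) := by positivity
    have h3 : |δ| ≤ ((tabsI S h U : ℝ) / S) ^ K * ((K + 2 : ℝ) / (((K + 1).factorial : ℝ) * (K + 1))) :=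
      h1.trans (mul_le_mul_of_nonneg_right h2 hc)
    have h4 : ((S : ℚ) * ((((tabsI S h U : ℤ) : ℚ) / S) ^ K *
        ((K + 2 : ℚ) / ((((K + 1).factorial : ℕ) : ℚ) * (K + 1)))) : ℝ) ≤ (tphiRem S (tabsI S h U) K : ℝ) := by
      unfold tphiRem; exact_mod_cast Int.le_ceil _
    refine le_trans ?_ h4
    push_cast
    nlinarith [h3, abs_nonneg δ, hSr.le]
  obtain ⟨bs, hbs, hev2⟩ := exists_widen0 has hδle ρ
  exact ⟨bs, hbs, by rw [hev2, ← hev, hδ]; ring⟩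

end PolyMP

end Literature.Analysis.ValidatedNumerics
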